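import Literature.Computability.AlgebraicComplexity.MS21ANFOrbitsSameDepthReduction
import HarnessLib

/-!
# Medini–Shpilka 2021, Lemma `pitRoanfSame` (§5.2.2): independent maps hit the difference of two
# ROANFs with the same leaves up to constants

The printed Lemma `pitRoanfSame` [MS21, §5.2.2, arXiv:2102.05632 p0030:L56–p0031:L24]: if
`f = ANF_Δ(ℓ_1, …, ℓ_N)` and `g = ANF_Δ(α_1ℓ_1, …, α_Nℓ_N)` (`N = 4^Δ`, the `ℓ_i` linearly independent)
and `f ≠ g`, then `(f - g) ∘ G ≠ 0` for every `(2Δ+2)`-independent map `G` (printed: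
`G = G_1 + G_{2Δ+1}`).  In the tree's vocabulary (`MS2021.affSubst`, `MS2021.anf`,
`MS2021.IsIndependent`): with the DIAGONAL SCALING `S_α := aeval (y_i ↦ α_i y_i)`,

  `bind₁ G (affSubst h A b (S_α ANF_Δ - ANF_Δ)) ≠ 0`

for `S_α ANF_Δ ≠ ANF_Δ`, `α_i ≠ 0`, `(A, b)` invertible affine, `G` `B`-independent, `B ≥ t + 2`,
`4^Δ ≤ 2^t` (`bind₁_affSubst_scale_anf_sub_anf_ne_zero`).  This is the "Case (ii)" endgame of the
equal-depth case of Thm 35 (after Lemma 5.12 `roanfMonInc` has put `ANF(My)` in the form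
`ANF(α · y_π)` with `π` a symmetry); it is characteristic-free.

Proof = the printed one (p0030:L58–p0031:L24), organised along the recursion of `ANF_Δ`:
* if `S_α ANF = c · ANF` then `c ≠ 1` and `f - g = (c-1)·ANF(Ax+b)` is hit by Thm 33
  (`bind₁_ne_zero_of_isROP_of_mem_affOrbit`) ("if `f = αg` … the lemma follows from Thm PITROPINV");
* otherwise the **deepest non-proportional node** `u` (`exists_node_data`, by induction on `Δ`: either
  all four blocks of `ANF_{Δ+1}` are proportional under their scalings — then `u` is the root — or one
  block is not and the data of that block lift through `∂_{x^{(b)}} ANF_{Δ+1} = ANF_Δ(x^{(sib b)}) ·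
  (∂ANF_Δ)(x^{(b)})`, Obs 5.8 = `pderiv_anf_succ`) provides leaves `w₁, w₃`, constants `a ≠ b` and
  products of renamed ROANFs `Γ, Q₁, Q₃` with
  `∂_{w₁} ANF = Γ Q₁`, `∂_{w₁} S_α ANF = a · S_αΓ · Q₁`, `∂_{w₃} ANF = Γ Q₃`, `∂_{w₃} S_α ANF = b · S_αΓ · Q₃`
  (the printed `∂f/∂v_1 = F f₂ ∂f₁/∂v_1 = (α F) g₂ ∂g₁/∂v₁`, eq. (anf-v1)/(anf-v3), with `F = S_αΓ`,
  `G = Γ`);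
* peel one block `G = G_1 + G'` (`isIndependent_succ_iff`); products of renamed ROANFs composed with
  an invertible affine map survive `G'` (Thm 33 factor by factor, `bind₁_affSubst_listProd_ne_zero`;
  for `S_αΓ` the scaling is absorbed into the affine map, `exists_affSubst_scale_eq`); if
  `a · (S_αΓ)∘ ≠ Γ∘` the derivative along the dual direction `v_{w₁}` survives `G'`, else `a ≠ b` makes
  the one along `v_{w₃}` survive; Lemma 3.9 (`bind₁_peel_ne_zero_of_dirDeriv`) concludes.

Theorems only; no definitions, no new named facts (D-0026; the "product of renamed ROANFs"
certificate is spelled out as an explicit `∃`-statement over a `List`).  HONEST FRAMING: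
infrastructure toward the typed literature statement `MS2021_thm_35` (equal-depth case, branch (ii)
of the homogeneous core `MS2021_thm_35_of_core`); `VP ≠ VNP` is NOT proved and nothing here bears on
it.

## References
* [MediniShpilka2021] D. Medini, A. Shpilka, CCC 2021 (LIPIcs 200:19) = arXiv:2102.05632: Lemma
  `pitRoanfSame` and its proof (§5.2.2, arXiv p0030:L56–p0031:L24); Obs 5.8 (p0025:L57–L60); Thm 33;
  Lemma 3.9.
-/

noncomputable section

open MvPolynomial
open scoped Matrix

namespace Literature.Computability.AlgebraicComplexity

namespace MS2021

/-! ### The diagonal scaling `S_α = aeval (y_i ↦ α_i y_i)` and the blocks of `ANF_{Δ+1}` -/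

section Scaling

variable (K : Type*) [Field K]

/-- `S_α` commutes with a renaming: `S_α (p ∘ ι) = (S_{α ∘ ι} p) ∘ ι` (scaling the leaves of a
sub-formula = scaling inside the sub-formula). [cite: MediniShpilka2021, §1.1.6 (CCC p.19:9); Def 8 (p0025:L28-L41)] -/
theorem aeval_scale_rename {σ τ : Type*} (ι : σ → τ) (α : τ → K) (p : MvPolynomial σ K) :
    aeval (fun i => C (α i) * X i) (rename ι p) =
      rename ι (aeval (fun j => C (α (ι j)) * X j) p) := by
  rw [aeval_rename, ← AlgHom.comp_apply, comp_aeval]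
  congr 2
  funext j
  simp only [Function.comp_apply, map_mul, rename_C, rename_X]

/-- Chain rule for the diagonal scaling: `∂_w (S_α p) = α_w · S_α (∂_w p)`.
[cite: MediniShpilka2021, Def 3.6 (chain rule display; arXiv p0017:L49-L51)] -/
theorem pderiv_aeval_scale {σ : Type*} [Fintype σ] [DecidableEq σ] (α : σ → K) (w : σ)
    (p : MvPolynomial σ K) :
    pderiv w (aeval (fun i => C (α i) * X i) p) =
      C (α w) * aeval (fun i => C (α i) * X i) (pderiv w p) := by
  rw [_root_.Literature.Algebra.Polynomial.JacobianCriterion.pderiv_aeval]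
  have hi : ∀ i : σ, aeval (fun i => C (α i) * X i) (pderiv i p) *
      pderiv w (C (α i) * X i : MvPolynomial σ K) =
      if i = w then C (α w) * aeval (fun i => C (α i) * X i) (pderiv w p) else 0 := by
    intro i
    rw [pderiv_C_mul, pderiv_X, Pi.single_apply]
    split_ifs with hiw
    · subst hiw; rw [mul_one, mul_comm]
    · rw [mul_zero, mul_zero]
  simp_rw [hi]
  rw [Finset.sum_ite_eq']
  simp

/-- `S_α` on a sum of two block products (the shape of `ANF_{Δ+1}`, block `b` first).
[cite: MediniShpilka2021, Def 8 (CCC p.19:7; arXiv p0025:L28-L41)] -/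
theorem aeval_scale_blocks {Δ : ℕ} (α : Fin (4 ^ (Δ + 1)) → K) (b₀ b₁ b₂ b₃ : Fin 4)
    (p q r s : MvPolynomial (Fin (4 ^ Δ)) K) :
    aeval (fun i => C (α i) * X i)
        (rename (anfBlock Δ b₀) p * rename (anfBlock Δ b₁) q +
          rename (anfBlock Δ b₂) r * rename (anfBlock Δ b₃) s) =
      rename (anfBlock Δ b₀) (aeval (fun j => C (α (anfBlock Δ b₀ j)) * X j) p) *
          rename (anfBlock Δ b₁) (aeval (fun j => C (α (anfBlock Δ b₁ j)) * X j) q) +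
        rename (anfBlock Δ b₂) (aeval (fun j => C (α (anfBlock Δ b₂ j)) * X j) r) *
          rename (anfBlock Δ b₃) (aeval (fun j => C (α (anfBlock Δ b₃ j)) * X j) s) := by
  simp only [map_add, map_mul, aeval_scale_rename]

/-- The three other blocks of the `b`-first display of `ANF_{Δ+1}` are not block `b`. [folklore] -/
private theorem sib_ne (b : Fin 4) : (1 - b) ≠ b ∧ (b + 2) ≠ b ∧ (1 - (b + 2)) ≠ b := by
  fin_cases b <;> decide

/-- Derivative along a block-`b` variable of a `b`-first sum of block products (Obs 5.8):
`∂_{x^{(b)}_j} (p(x^{(b)}) q(x^{(sib b)}) + r s) = q(x^{(sib b)}) · (∂_j p)(x^{(b)})`.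
[cite: MediniShpilka2021, Obs 5.8 (arXiv p0025:L57–L60)] -/
theorem pderiv_anfBlock_blocks {Δ : ℕ} (b : Fin 4) (j : Fin (4 ^ Δ))
    (p q r s : MvPolynomial (Fin (4 ^ Δ)) K) :
    pderiv (anfBlock Δ b j)
        (rename (anfBlock Δ b) p * rename (anfBlock Δ (1 - b)) q +
          rename (anfBlock Δ (b + 2)) r * rename (anfBlock Δ (1 - (b + 2))) s) =
      rename (anfBlock Δ (1 - b)) q * rename (anfBlock Δ b) (pderiv j p) := by
  obtain ⟨h1, h2, h3⟩ := sib_ne b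
  rw [map_add, Derivation.leibniz, Derivation.leibniz, pderiv_anfBlock_rename_self,
    pderiv_anfBlock_rename_of_ne K h1, pderiv_anfBlock_rename_of_ne K h2,
    pderiv_anfBlock_rename_of_ne K h3]
  simp only [smul_eq_mul, mul_zero, zero_add, add_zero]

end Scaling

/-! ### Products of renamed ROANFs: certificates and their hitting -/

section Certificates

variable (K : Type*) [Field K]

/-- `1` is an (empty) product of renamed ROANFs. [folklore] -/
private theorem listProd_cert_one (N : ℕ) :
    ∃ Fs : List (MvPolynomial (Fin N) K), (1 : MvPolynomial (Fin N) K) = Fs.prod ∧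
      ∀ q ∈ Fs, ∃ (Δ' : ℕ) (ι : Fin (4 ^ Δ') → Fin N),
        Function.Injective ι ∧ q = rename ι (anf K Δ') :=
  ⟨[], by simp, fun q hq => by simp at hq⟩

/-- A renamed ROANF is a product of renamed ROANFs. [folklore] -/
private theorem listProd_cert_rename_anf {N Δ' : ℕ} (ι : Fin (4 ^ Δ') → Fin N)
    (hι : Function.Injective ι) :
    ∃ Fs : List (MvPolynomial (Fin N) K), rename ι (anf K Δ') = Fs.prod ∧
      ∀ q ∈ Fs, ∃ (Δ'' : ℕ) (ι' : Fin (4 ^ Δ'') → Fin N),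
        Function.Injective ι' ∧ q = rename ι' (anf K Δ'') :=
  ⟨[rename ι (anf K Δ')], by simp, fun q hq => by
    simp only [List.mem_singleton] at hq
    exact ⟨Δ', ι, hι, hq⟩⟩

/-- Products of renamed ROANFs are closed under products. [folklore] -/
private theorem listProd_cert_mul {N : ℕ} {X Y : MvPolynomial (Fin N) K}
    (hX : ∃ Fs : List (MvPolynomial (Fin N) K), X = Fs.prod ∧
      ∀ q ∈ Fs, ∃ (Δ' : ℕ) (ι : Fin (4 ^ Δ') → Fin N),
        Function.Injective ι ∧ q = rename ι (anf K Δ'))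
    (hY : ∃ Fs : List (MvPolynomial (Fin N) K), Y = Fs.prod ∧
      ∀ q ∈ Fs, ∃ (Δ' : ℕ) (ι : Fin (4 ^ Δ') → Fin N),
        Function.Injective ι ∧ q = rename ι (anf K Δ')) :
    ∃ Fs : List (MvPolynomial (Fin N) K), X * Y = Fs.prod ∧
      ∀ q ∈ Fs, ∃ (Δ' : ℕ) (ι : Fin (4 ^ Δ') → Fin N),
        Function.Injective ι ∧ q = rename ι (anf K Δ') := by
  obtain ⟨Fs, rfl, hFs⟩ := hX
  obtain ⟨Gs, rfl, hGs⟩ := hY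
  refine ⟨Fs ++ Gs, by rw [List.prod_append], fun q hq => ?_⟩
  rw [List.mem_append] at hq
  exact hq.elim (hFs q) (hGs q)

/-- Products of renamed ROANFs are stable under a block renaming. [folklore] -/
private theorem listProd_cert_rename_anfBlock {Δ : ℕ} (b : Fin 4) {X : MvPolynomial (Fin (4 ^ Δ)) K}
    (hX : ∃ Fs : List (MvPolynomial (Fin (4 ^ Δ)) K), X = Fs.prod ∧
      ∀ q ∈ Fs, ∃ (Δ' : ℕ) (ι : Fin (4 ^ Δ') → Fin (4 ^ Δ)),
        Function.Injective ι ∧ q = rename ι (anf K Δ')) :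
    ∃ Fs : List (MvPolynomial (Fin (4 ^ (Δ + 1))) K), rename (anfBlock Δ b) X = Fs.prod ∧
      ∀ q ∈ Fs, ∃ (Δ' : ℕ) (ι : Fin (4 ^ Δ') → Fin (4 ^ (Δ + 1))),
        Function.Injective ι ∧ q = rename ι (anf K Δ') := by
  obtain ⟨Fs, rfl, hFs⟩ := hX
  refine ⟨Fs.map (rename (anfBlock Δ b)), map_list_prod _ _, fun q hq => ?_⟩
  rw [List.mem_map] at hq
  obtain ⟨q', hq', rfl⟩ := hq
  obtain ⟨Δ', ι, hι, rfl⟩ := hFs q' hq'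
  exact ⟨Δ', anfBlock Δ b ∘ ι, (anfBlock_injective Δ b).comp hι, by rw [rename_rename]⟩

/-- **Obs 5.8**: every first partial derivative of `ANF_Δ` is a product of renamed (sibling)
ROANFs. [cite: MediniShpilka2021, Obs 5.8 (arXiv p0025:L57–L60)] -/
theorem listProd_cert_pderiv_anf : ∀ (Δ : ℕ) (j : Fin (4 ^ Δ)),
    ∃ Fs : List (MvPolynomial (Fin (4 ^ Δ)) K), pderiv j (anf K Δ) = Fs.prod ∧
      ∀ q ∈ Fs, ∃ (Δ' : ℕ) (ι : Fin (4 ^ Δ') → Fin (4 ^ Δ)),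
        Function.Injective ι ∧ q = rename ι (anf K Δ')
  | 0, j => by
    refine ⟨[], ?_, fun q hq => by simp at hq⟩
    have hj : j = ⟨0, by norm_num⟩ := by
      ext; have := j.2; simp only [pow_zero] at this; simp only; omega
    subst hj
    simp [anf]
  | Δ + 1, x => by
    obtain ⟨b, j, rfl⟩ := exists_eq_anfBlock Δ x
    rw [pderiv_anf_succ]
    exact listProd_cert_mul K (listProd_cert_rename_anf K _ (anfBlock_injective Δ _))
      (listProd_cert_rename_anfBlock K b (listProd_cert_pderiv_anf Δ j))

variable {K} {n : ℕ}

/-- **Products of renamed ROANFs composed with an invertible affine map survive every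
`(t+1)`-independent map** (`4^Δ ≤ 2^t`) — Thm 33 factor by factor ("Thm PITROPINV and Obs derivCroanf
imply that `(g₂ ∂g₁/∂v₁) ∘ G_{2Δ+1} ≠ 0`").
[cite: MediniShpilka2021, proof of Lemma pitRoanfSame (arXiv p0031:L19–L21); Thm 33] -/
theorem bind₁_affSubst_listProd_ne_zero {Δ t : ℕ} (ht : 4 ^ Δ ≤ 2 ^ t)
    (Fs : List (MvPolynomial (Fin (4 ^ Δ)) K))
    (hFs : ∀ q ∈ Fs, ∃ (Δ' : ℕ) (ι : Fin (4 ^ Δ') → Fin (4 ^ Δ)),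
        Function.Injective ι ∧ q = rename ι (anf K Δ'))
    (h : 4 ^ Δ ≤ n) {A : Matrix (Fin n) (Fin n) K} (hA : IsUnit A.det) (b : Fin n → K)
    {B c : ℕ} (G : Fin n → MvPolynomial (Fin B × (Fin c ⊕ Unit)) K) (hG : IsIndependent B G)
    (hB : t + 1 ≤ B) : bind₁ G (affSubst h A b Fs.prod) ≠ 0 := by
  classical
  obtain ⟨t', rfl⟩ : ∃ t', B = t' + 1 := ⟨B - 1, by omega⟩
  induction Fs with
  | nil =>
    rw [List.prod_nil, ← C_1, affSubst_C, bind₁_C_right, C_1]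
    exact one_ne_zero
  | cons q Fs ih =>
    rw [List.prod_cons, affSubst_mul, map_mul]
    refine mul_ne_zero ?_ (ih fun q' hq' => hFs q' (List.mem_cons_of_mem q hq'))
    obtain ⟨Δ', ι, hι, rfl⟩ := hFs q List.mem_cons_self
    have hrop : IsROP ((Finset.univ : Finset (Fin (4 ^ Δ'))).image ι) (rename ι (anf K Δ')) :=
      (isROP_anf K Δ').rename ι hι
    have hcard : ((Finset.univ : Finset (Fin (4 ^ Δ'))).image ι).card ≤ 2 ^ t' := by
      calc ((Finset.univ : Finset (Fin (4 ^ Δ'))).image ι).card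
          ≤ (Finset.univ : Finset (Fin (4 ^ Δ))).card := Finset.card_le_univ _
        _ = 4 ^ Δ := by rw [Finset.card_univ, Fintype.card_fin]
        _ ≤ 2 ^ t := ht
        _ ≤ 2 ^ t' := Nat.pow_le_pow_right (by norm_num) (by omega)
    have hne : rename ι (anf K Δ') ≠ 0 := fun h0 =>
      anf_ne_zero K Δ' (rename_injective ι hι (by rw [h0, map_zero]))
    exact bind₁_ne_zero_of_isROP_of_mem_affOrbit hrop hcard ⟨h, A, b, hA, rfl⟩
      (affSubst_ne_zero h hA b hne) hG

/-- **The diagonal scaling is absorbed into the affine map**: for `α_i ≠ 0` there is an invertible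
affine `(A', b')` (the first `4^Δ` rows of `(A, b)` scaled by the `α_i`) with
`(S_α g)(Ax + b) = g(A'x + b')` for every `g`. [cite: MediniShpilka2021, §1.1.6 (CCC p.19:9)] -/
theorem exists_affSubst_scale_eq {N : ℕ} (α : Fin N → K) (hα : ∀ i, α i ≠ 0) (h : N ≤ n)
    {A : Matrix (Fin n) (Fin n) K} (hA : IsUnit A.det) (b : Fin n → K) :
    ∃ (A' : Matrix (Fin n) (Fin n) K) (b' : Fin n → K), IsUnit A'.det ∧
      ∀ g : MvPolynomial (Fin N) K,
        affSubst h A b (aeval (fun i => C (α i) * X i) g) = affSubst h A' b' g := by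
  classical
  -- the scaling factors, extended by `1`
  set d : Fin n → K := fun l => if hl : (l : ℕ) < N then α ⟨l, hl⟩ else 1 with hd
  have hdl : ∀ i : Fin N, d (Fin.castLE h i) = α i := by
    intro i
    rw [hd]
    simp only [Fin.val_castLE, Fin.is_lt, dif_pos, Fin.eta]
  have hdne : ∀ l, d l ≠ 0 := by
    intro l
    rw [hd]
    simp only
    split_ifs with hl
    · exact hα _
    · exact one_ne_zero
  refine ⟨Matrix.diagonal d * A, fun l => d l * b l, ?_, ?_⟩
  · rw [Matrix.det_mul, Matrix.det_diagonal]
    exact (isUnit_iff_ne_zero.mpr (Finset.prod_ne_zero_iff.mpr fun l _ => hdne l)).mul hA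
  · intro g
    simp only [affSubst]
    rw [← AlgHom.comp_apply, comp_aeval]
    congr 2
    funext i
    simp only [map_mul, aeval_C, aeval_X, algebraMap_eq, Matrix.diagonal_mul, hdl, mul_add,
      Finset.mul_sum]
    congr 1
    refine Finset.sum_congr rfl fun k _ => ?_
    rw [mul_assoc]

end Certificates

/-! ### The deepest non-proportional node (data for the two dual derivatives) -/

section Node

variable (K : Type*) [Field K]

/-- **The deepest non-proportional node of `ANF_Δ` vs `S_α ANF_Δ`.**  If `S_α ANF_Δ` is not a scalar
multiple of `ANF_Δ`, there are leaves `w₁, w₃`, constants `a ≠ b` and products of renamed ROANFs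
`Γ, Q₁, Q₃` with `∂_{w₁} ANF = Γ Q₁`, `∂_{w₃} ANF = Γ Q₃`, `∂_{w₁} S_α ANF = a · S_αΓ · Q₁`,
`∂_{w₃} S_α ANF = b · S_αΓ · Q₃` — the printed "`u_f = f₁f₂ + f₃f₄`, `u_g = g₁g₂ + g₃g₄`,
`f₁f₂ = α g₁g₂`, `f₃f₄ = β g₃g₄`, `α ≠ β`" and the displays `∂f/∂v₁ = F f₂ ∂f₁/∂v₁`, … with
`F = S_αΓ`, `G = Γ`, `g₂ ∂g₁/∂v₁ = Q₁`, `g₄ ∂g₃/∂v₃ = Q₃`.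
[cite: MediniShpilka2021, proof of Lemma pitRoanfSame (arXiv p0030:L58–p0031:L12)] -/
theorem exists_node_data : ∀ (Δ : ℕ) (α : Fin (4 ^ Δ) → K),
    (∀ c : K, aeval (fun i => C (α i) * X i) (anf K Δ) ≠ C c * anf K Δ) →
    ∃ (w₁ w₃ : Fin (4 ^ Δ)) (a b : K) (Γ Q₁ Q₃ : MvPolynomial (Fin (4 ^ Δ)) K),
      a ≠ b ∧
      (∃ Fs : List (MvPolynomial (Fin (4 ^ Δ)) K), Γ = Fs.prod ∧
        ∀ q ∈ Fs, ∃ (Δ' : ℕ) (ι : Fin (4 ^ Δ') → Fin (4 ^ Δ)),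
          Function.Injective ι ∧ q = rename ι (anf K Δ')) ∧
      (∃ Fs : List (MvPolynomial (Fin (4 ^ Δ)) K), Q₁ = Fs.prod ∧
        ∀ q ∈ Fs, ∃ (Δ' : ℕ) (ι : Fin (4 ^ Δ') → Fin (4 ^ Δ)),
          Function.Injective ι ∧ q = rename ι (anf K Δ')) ∧
      (∃ Fs : List (MvPolynomial (Fin (4 ^ Δ)) K), Q₃ = Fs.prod ∧
        ∀ q ∈ Fs, ∃ (Δ' : ℕ) (ι : Fin (4 ^ Δ') → Fin (4 ^ Δ)),
          Function.Injective ι ∧ q = rename ι (anf K Δ')) ∧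
      pderiv w₁ (anf K Δ) = Γ * Q₁ ∧ pderiv w₃ (anf K Δ) = Γ * Q₃ ∧
      pderiv w₁ (aeval (fun i => C (α i) * X i) (anf K Δ)) =
        C a * aeval (fun i => C (α i) * X i) Γ * Q₁ ∧
      pderiv w₃ (aeval (fun i => C (α i) * X i) (anf K Δ)) =
        C b * aeval (fun i => C (α i) * X i) Γ * Q₃
  | 0, α, hα => by
    exfalso
    apply hα (α ⟨0, by norm_num⟩)
    simp [anf]
  | Δ + 1, α, hα => by
    classical
    -- the four sub-scalings
    by_cases hall : ∀ b : Fin 4, ∃ c : K,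
        aeval (fun j => C (α (anfBlock Δ b j)) * X j) (anf K Δ) = C c * anf K Δ
    · -- Case 1: every block is proportional — the root is the deepest non-proportional node
      choose c hc using hall
      have j₀ : Fin (4 ^ Δ) := ⟨0, pow_pos (by norm_num) Δ⟩
      -- `S_α ANF_{Δ+1}` in the `b`-first display
      have hS : ∀ b : Fin 4, aeval (fun i => C (α i) * X i) (anf K (Δ + 1)) =
          rename (anfBlock Δ b) (C (c b) * anf K Δ) *
              rename (anfBlock Δ (1 - b)) (C (c (1 - b)) * anf K Δ) +
            rename (anfBlock Δ (b + 2)) (C (c (b + 2)) * anf K Δ) *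
              rename (anfBlock Δ (1 - (b + 2))) (C (c (1 - (b + 2))) * anf K Δ) := by
        intro b
        rw [anf_succ_eq_block K Δ b, aeval_scale_blocks, hc, hc, hc, hc]
      -- the derivative along a block-`b` leaf picks the coefficient `c_b c_{sib b}`
      have hD : ∀ b : Fin 4,
          pderiv (anfBlock Δ b j₀) (aeval (fun i => C (α i) * X i) (anf K (Δ + 1))) =
            C (c b * c (1 - b)) *
                aeval (fun i => C (α i) * X i) (1 : MvPolynomial (Fin (4 ^ (Δ + 1))) K) *
              pderiv (anfBlock Δ b j₀) (anf K (Δ + 1)) := by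
        intro b
        rw [hS b, pderiv_anfBlock_blocks, map_one, pderiv_anf_succ]
        simp only [map_mul, rename_C, pderiv_C_mul]
        ring
      -- the two coefficients differ (else `S_α ANF = c₀c₁ · ANF`)
      have h10 : (1 : Fin 4) - 0 = 1 := by decide
      have h02 : (0 : Fin 4) + 2 = 2 := by decide
      have h12 : (1 : Fin 4) - 2 = 3 := by decide
      have hab : c 0 * c (1 - 0) ≠ c 2 * c (1 - 2) := by
        intro heq
        rw [h10, h12] at heq
        apply hα (c 0 * c 1)
        rw [hS 0, anf_succ K Δ]
        simp only [h10, h02, h12, map_mul, rename_C]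
        have e2 : (C (c 2) : MvPolynomial (Fin (4 ^ (Δ + 1))) K) * C (c 3) = C (c 0) * C (c 1) := by
          rw [← map_mul, ← map_mul, heq]
        linear_combination
          (rename (anfBlock Δ 2) (anf K Δ) * rename (anfBlock Δ 3) (anf K Δ)) * e2
      exact ⟨anfBlock Δ 0 j₀, anfBlock Δ 2 j₀, c 0 * c (1 - 0), c 2 * c (1 - 2), 1,
        pderiv (anfBlock Δ 0 j₀) (anf K (Δ + 1)), pderiv (anfBlock Δ 2 j₀) (anf K (Δ + 1)), hab,
        listProd_cert_one K _, listProd_cert_pderiv_anf K _ _, listProd_cert_pderiv_anf K _ _,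
        (one_mul _).symm, (one_mul _).symm, hD 0, hD 2⟩
    · -- Case 2: block `b₀` is not proportional — lift its node data through Obs 5.8
      push Not at hall
      obtain ⟨b₀, hb₀⟩ := hall
      obtain ⟨w₁, w₃, a, b, Γ, Q₁, Q₃, hab, hΓ, hQ₁, hQ₃, e₁, e₃, f₁, f₃⟩ :=
        exists_node_data Δ (fun j => α (anfBlock Δ b₀ j)) hb₀
      refine ⟨anfBlock Δ b₀ w₁, anfBlock Δ b₀ w₃, a, b,
        rename (anfBlock Δ (1 - b₀)) (anf K Δ) * rename (anfBlock Δ b₀) Γ,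
        rename (anfBlock Δ b₀) Q₁, rename (anfBlock Δ b₀) Q₃, hab,
        listProd_cert_mul K (listProd_cert_rename_anf K _ (anfBlock_injective Δ _))
          (listProd_cert_rename_anfBlock K b₀ hΓ),
        listProd_cert_rename_anfBlock K b₀ hQ₁, listProd_cert_rename_anfBlock K b₀ hQ₃,
        ?_, ?_, ?_, ?_⟩
      · rw [pderiv_anf_succ, e₁, map_mul, mul_assoc]
      · rw [pderiv_anf_succ, e₃, map_mul, mul_assoc]
      · rw [anf_succ_eq_block K Δ b₀, aeval_scale_blocks, pderiv_anfBlock_blocks, f₁]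
        simp only [map_mul, rename_C, aeval_scale_rename]
        ring
      · rw [anf_succ_eq_block K Δ b₀, aeval_scale_blocks, pderiv_anfBlock_blocks, f₃]
        simp only [map_mul, rename_C, aeval_scale_rename]
        ring

end Node

/-! ### Lemma `pitRoanfSame`: the diagonal case is hit -/

section Diagonal

variable {K : Type*} [Field K] {n : ℕ}

/-- **Lemma `pitRoanfSame` (diagonal form), every field.**  Let `α_i ≠ 0` with
`S_α ANF_Δ ≠ ANF_Δ` (`S_α = (y_i ↦ α_i y_i)`).  Then for every invertible affine `(A, b)` and every
`B`-independent `G` with `B ≥ t + 2`, `4^Δ ≤ 2^t` (printed: `G = G_1 + G_{2Δ+1}`),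
`(S_α ANF_Δ - ANF_Δ)(Ax + b) ∘ G ≠ 0` — "a hitting set for the difference of two polynomials in
`ANF_Δ` that, up to constant factors, have the same linear functions on the leaves".
[cite: MediniShpilka2021, Lemma pitRoanfSame and its proof (§5.2.2, arXiv p0030:L56–p0031:L24)] -/
theorem bind₁_affSubst_scale_anf_sub_anf_ne_zero {Δ t B c : ℕ} (α : Fin (4 ^ Δ) → K)
    (hα : ∀ i, α i ≠ 0) (hne : aeval (fun i => C (α i) * X i) (anf K Δ) ≠ anf K Δ)
    (h : 4 ^ Δ ≤ n) {A : Matrix (Fin n) (Fin n) K} (hA : IsUnit A.det) (b : Fin n → K)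
    (ht : 4 ^ Δ ≤ 2 ^ t) (G : Fin n → MvPolynomial (Fin B × (Fin c ⊕ Unit)) K)
    (hG : IsIndependent B G) (hB : t + 2 ≤ B) :
    bind₁ G (affSubst h A b (aeval (fun i => C (α i) * X i) (anf K Δ) - anf K Δ)) ≠ 0 := by
  classical
  by_cases hprop : ∃ c₀ : K, aeval (fun i => C (α i) * X i) (anf K Δ) = C c₀ * anf K Δ
  · -- `f = c g`: `f - g = (c - 1) ANF(Ax + b)`, Thm 33
    obtain ⟨c₀, hc₀⟩ := hprop
    have hc1 : c₀ - 1 ≠ 0 := by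
      intro h0
      rw [sub_eq_zero] at h0
      rw [h0, C_1, one_mul] at hc₀
      exact hne hc₀
    obtain ⟨t', rfl⟩ : ∃ t', B = t' + 1 := ⟨B - 1, by omega⟩
    have hform : aeval (fun i => C (α i) * X i) (anf K Δ) - anf K Δ = C (c₀ - 1) * anf K Δ := by
      rw [hc₀, map_sub, C_1, sub_mul, one_mul]
    rw [hform, affSubst_mul, affSubst_C, map_mul, bind₁_C_right]
    refine mul_ne_zero (by rwa [Ne, C_eq_zero]) ?_
    have hcard : (Finset.univ : Finset (Fin (4 ^ Δ))).card ≤ 2 ^ t' := by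
      rw [Finset.card_univ, Fintype.card_fin]
      exact ht.trans (Nat.pow_le_pow_right (by norm_num) (by omega))
    exact bind₁_ne_zero_of_isROP_of_mem_affOrbit (isROP_anf K Δ) hcard ⟨h, A, b, hA, rfl⟩
      (affSubst_ne_zero h hA b (anf_ne_zero K Δ)) hG
  · -- the deepest non-proportional node
    push Not at hprop
    obtain ⟨w₁, w₃, a, b', Γ, Q₁, Q₃, hab, hΓ, hQ₁, hQ₃, e₁, e₃, f₁, f₃⟩ :=
      exists_node_data K Δ α hprop
    -- peel one block: `G = G_1 + G'`
    obtain ⟨B', rfl⟩ : ∃ B', B = B' + 1 := ⟨B - 1, by omega⟩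
    obtain ⟨G₁, G', hG₁, hG', hGeq⟩ := isIndependent_succ_iff.mp hG
    have hGfun : G = fun j => rename (Prod.mk 0) (G₁ j) + rename (Prod.map Fin.succ id) (G' j) :=
      funext hGeq
    rw [hGfun]
    -- the surviving factors after `G'`
    obtain ⟨FsΓ, hFsΓ, hFsΓ'⟩ := hΓ
    obtain ⟨Fs₁, hFs₁, hFs₁'⟩ := hQ₁
    obtain ⟨Fs₃, hFs₃, hFs₃'⟩ := hQ₃
    have hQ₁G : bind₁ G' (affSubst h A b Q₁) ≠ 0 := by
      rw [hFs₁]; exact bind₁_affSubst_listProd_ne_zero ht Fs₁ hFs₁' h hA b G' hG' (by omega)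
    have hQ₃G : bind₁ G' (affSubst h A b Q₃) ≠ 0 := by
      rw [hFs₃]; exact bind₁_affSubst_listProd_ne_zero ht Fs₃ hFs₃' h hA b G' hG' (by omega)
    have hΓG : bind₁ G' (affSubst h A b (aeval (fun i => C (α i) * X i) Γ)) ≠ 0 := by
      obtain ⟨A', b'', hA', hid⟩ := exists_affSubst_scale_eq α hα h hA b
      rw [hid, hFsΓ]
      exact bind₁_affSubst_listProd_ne_zero ht FsΓ hFsΓ' h hA' b'' G' hG' (by omega)
    -- the derivative of `f - g` along the dual direction `v_w`, after `G'`
    have hder : ∀ (w : Fin (4 ^ Δ)) (e : K) (Q : MvPolynomial (Fin (4 ^ Δ)) K),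
        pderiv w (anf K Δ) = Γ * Q →
        pderiv w (aeval (fun i => C (α i) * X i) (anf K Δ)) =
          C e * aeval (fun i => C (α i) * X i) Γ * Q →
        bind₁ G' (∑ j, C (A⁻¹ j (Fin.castLE h w)) * pderiv j
          (affSubst h A b (aeval (fun i => C (α i) * X i) (anf K Δ) - anf K Δ))) =
          (C e * bind₁ G' (affSubst h A b (aeval (fun i => C (α i) * X i) Γ)) -
              bind₁ G' (affSubst h A b Γ)) * bind₁ G' (affSubst h A b Q) := by
      intro w e Q he hf
      rw [sum_C_mul_pderiv_affSubst h hA b _ w, map_sub, he, hf]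
      simp only [affSubst, map_sub, map_mul, algHom_C, algebraMap_eq]
      ring
    by_cases hcase : C a * bind₁ G' (affSubst h A b (aeval (fun i => C (α i) * X i) Γ)) =
        bind₁ G' (affSubst h A b Γ)
    · -- use `v_{w₃}`: the coefficient is `(b - a) · (S_αΓ)∘ ≠ 0`
      refine bind₁_peel_ne_zero_of_dirDeriv hG₁ G' _ (fun j => A⁻¹ j (Fin.castLE h w₃)) ?_
      rw [hder w₃ b' Q₃ e₃ f₃, ← hcase, ← sub_mul, ← map_sub]
      refine mul_ne_zero (mul_ne_zero ?_ hΓG) hQ₃G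
      rw [Ne, C_eq_zero, sub_eq_zero]
      exact fun h0 => hab h0.symm
    · -- use `v_{w₁}`
      refine bind₁_peel_ne_zero_of_dirDeriv hG₁ G' _ (fun j => A⁻¹ j (Fin.castLE h w₁)) ?_
      rw [hder w₁ a Q₁ e₁ f₁]
      exact mul_ne_zero (sub_ne_zero.mpr hcase) hQ₁G

end Diagonal

end MS2021

end Literature.Computability.AlgebraicComplexity

end
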